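import Summits.Ventures.CertifiedManyBodySolver.Downfold.EmeryShapeTrueCornerRule
import Summits.Ventures.CertifiedManyBodySolver.Downfold.EmeryFermiScalePointsNCCOK26TrueCorners
import Summits.Ventures.CertifiedManyBodySolver.Downfold.EmeryFermiScalePointsNCCOK26VirtualCorners
import HarnessLib

/-!
# THE ONE-BAND FERMI-SURFACE SHAPE `t′/t` OF THE WHOLE TYPED 3BE BOX `emeryBoxNCCOK26Src (EmeryBoxesKSlicesB)` AT ITS TWO TRUE CORNERS (true-corner rule under certified margins, §B.87 (i);
# router/EMERY-SHAPE-CORNERS.tsv «true» rows)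

Venture CertifiedManyBodySolver, cell `pub/hubbard-downfold` (stage S1; INFLATION-RULES-3to1-B §B.87 (i)), seat hubbard-downfold-mod-4 (technique B, g35); namespace
`Summit.Ventures.CertifiedManyBodySolver.Downfold.Emery`. Everything PROVED (0 sorry). WHAT THIS IS NOT: a statement about Nd₂₋ₓCeₓCuO₄ x = 0.15 (electron-doped; (K) #24 source box) — the typed box is SCREENING-GRADE; `U = 0`
one-body kinematics of the σ model; object E = the EXACT `t–t′` shape of the σ Fermi surface at the row's own Fermi energy.

For EVERY one-body row of `[1, 2.05] × [0.9, 1.29] × [0.52, 0.72] × [0.02, 0.02]` eV the one-band `t′/t` lies between its values at the TRUE corners `(Δ₁, a₁, b₂, c₂)` and `(Δ₂, a₂, b₁, c₁)`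
(`EmeryShapeTrueCornerRule`; the t_pp / t_pp′ directions by the MARGIN LEVERS of `EmeryMarginLevers`, margins certified by `norm_num` with the constants `M` printed below), read
over their K = 384 brackets (`EmeryFermiScalePointsNCCOK26TrueCorners`).

| filling | **true-corner window (certified)** | margins (t_pp lower/upper; t_pp′ lower/upper) | two-ray (§B.86 (i)) | g19 sub-box device |
|---|---|---|---|---|
| n_H = 0.85 (ν = 23/40) | **[-0.3306, -0.2064]** | M_b 0.4135 / 2.9042; M_c 0.0 / 0.0 | see EmeryBoxesNCCOK26ShapeCorners | [-0.3374,-0.1998] |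

Sources: three-band model [HybertsenSchluterChristensen1989, Eq. (1)]; [AndersenEtAl1995, §6]; box rows as cited in the typed object's file.
-/

noncomputable section

namespace Summit.Ventures.CertifiedManyBodySolver.Downfold.Emery

open Real Set

/-- **n_H = 0.85 (ν = 23/40): for every row of the box the one-band Fermi-surface `t′/t` (object E) lies in `[-0.3306, -0.2064]` — its values at the two TRUE corners** (margin levers; margins by `norm_num`). [folklore] -/
theorem nCCOK26Box_fsRatio_true_nH085 {Δ a b c : ℝ} (hΔ : Δ ∈ Icc (1 : ℝ) ((41 : ℝ) / 20)) (ha : a ∈ Icc ((9 : ℝ) / 10) ((129 : ℝ) / 100)) (hb : b ∈ Icc ((13 : ℝ) / 25) ((18 : ℝ) / 25)) (hc : c ∈ Icc ((1 : ℝ) / 50) ((1 : ℝ) / 50)) :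
    fsRatio Δ a b c (fermiEnergyOf Δ a b c ((23 : ℝ) / 40)) ∈ Icc ((-1653 : ℝ) / 5000) ((-129 : ℝ) / 625) := by
  have hSL := (fermiEnergyOf_of_pointBracketCheck truePt_NCCOK26SL_nH085_br (by norm_num) (by norm_num) (by norm_num) (ν := (23/40 : ℝ)) (by push_cast; exact ⟨le_rfl, le_rfl⟩)).2
  have hTL := (fermiEnergyOf_of_pointBracketCheck truePt_NCCOK26TL_nH085_br (by norm_num) (by norm_num) (by norm_num) (ν := (23/40 : ℝ)) (by push_cast; exact ⟨le_rfl, le_rfl⟩)).2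
  have hSU := (fermiEnergyOf_of_pointBracketCheck truePt_NCCOK26SU_nH085_br (by norm_num) (by norm_num) (by norm_num) (ν := (23/40 : ℝ)) (by push_cast; exact ⟨le_rfl, le_rfl⟩)).2
  have hQU := (fermiEnergyOf_of_pointBracketCheck truePt_NCCOK26QU_nH085_br (by norm_num) (by norm_num) (by norm_num) (ν := (23/40 : ℝ)) (by push_cast; exact ⟨le_rfl, le_rfl⟩)).2
  have hTH := (fermiEnergyOf_of_pointBracketCheck truePt_NCCOK26SU_nH085_br (by norm_num) (by norm_num) (by norm_num) (ν := (23/40 : ℝ)) (by push_cast; exact ⟨le_rfl, le_rfl⟩)).2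
  have hAlo := (fermiEnergyOf_of_pointBracketCheck virtPt_NCCOK26Alo_nH085_br (by norm_num) (by norm_num) (by norm_num) (ν := (23/40 : ℝ)) (by push_cast; exact ⟨le_rfl, le_rfl⟩)).2
  have hTop := (fermiEnergyOf_of_pointBracketCheck virtPt_NCCOK26H_nH085_br (by norm_num) (by norm_num) (by norm_num) (ν := (23/40 : ℝ)) (by push_cast; exact ⟨le_rfl, le_rfl⟩)).2
  push_cast at hSL hTL hSU hQU hTH hAlo hTop
  norm_num at hSL hTL hSU hQU hTH hAlo hTop
  obtain ⟨hΔl, hΔu⟩ := hΔ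
  obtain ⟨hal, hau⟩ := ha
  constructor
  · have hlow := fsRatio_fermiEnergyOf_trueCorner_lower (Δ₁ := (1 : ℝ)) (a₁ := ((9 : ℝ) / 10)) (b₁ := ((13 : ℝ) / 25)) (b₂ := ((18 : ℝ) / 25)) (c₁ := ((1 : ℝ) / 50)) (c₂ := ((1 : ℝ) / 50))
      (ν := ((23 : ℝ) / 40)) (pL := ((3461 : ℝ) / 2000)) (qL := ((153 : ℝ) / 80)) (Mb := ((827 : ℝ) / 2000)) (Mc := (0 : ℝ)) (by norm_num) hΔl (by norm_num) hal (by norm_num) hb (by norm_num) hc (by norm_num) (by norm_num) (by norm_num)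
      (by norm_num) hSL.1 hAlo.2 (by norm_num) (by norm_num [fsD, fsN]) (by norm_num) (by norm_num) (by norm_num [fsD, fsN]) (by norm_num) (by norm_num [dopingDisc]) (by norm_num [fsD, fsN])
    refine le_trans ?_ hlow
    have hw := (fsRatio_mem_Icc_on_window_of_dopingDisc_nonpos (Δ := (1 : ℝ)) (a := ((9 : ℝ) / 10)) (b := ((18 : ℝ) / 25)) (c := ((1 : ℝ) / 50))
      (p := ((759 : ℝ) / 400)) (q := ((153 : ℝ) / 80)) (by norm_num) (by norm_num) (by norm_num) (by norm_num) (by norm_num) (by norm_num) (by norm_num) (by norm_num [dopingDisc]) hTL).1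
    refine le_trans ?_ hw
    norm_num [fsRatio, fsD, fsN]
  · have hup := fsRatio_fermiEnergyOf_trueCorner_upper (Δ₁ := (1 : ℝ)) (Δ₂ := ((41 : ℝ) / 20)) (a₁ := ((9 : ℝ) / 10)) (a₂ := ((129 : ℝ) / 100)) (b₁ := ((13 : ℝ) / 25)) (b₂ := ((18 : ℝ) / 25)) (c₁ := ((1 : ℝ) / 50)) (c₂ := ((1 : ℝ) / 50))
      (ν := ((23 : ℝ) / 40)) (pU := ((20733 : ℝ) / 10000)) (qU := ((5541 : ℝ) / 2500)) (qT := ((27023 : ℝ) / 10000)) (Mb := ((14521 : ℝ) / 5000)) (Mc := (0 : ℝ)) (by norm_num) ⟨hΔl, hΔu⟩ (by norm_num) ⟨hal, hau⟩ (by norm_num) hb (by norm_num) hc (by norm_num) (by norm_num) (by norm_num)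
      hTop.2 (by norm_num) (by norm_num) hSU.1 hQU.2 (by norm_num) (by norm_num [fsD, fsN]) (by norm_num) (by norm_num) (by norm_num [fsD, fsN]) (by norm_num) (by norm_num) (by norm_num [fsD, fsN])
    refine le_trans hup ?_
    have hw := (fsRatio_mem_Icc_on_window_of_dopingDisc_nonpos (Δ := ((41 : ℝ) / 20)) (a := ((129 : ℝ) / 100)) (b := ((13 : ℝ) / 25)) (c := ((1 : ℝ) / 50))
      (p := ((20733 : ℝ) / 10000)) (q := ((20883 : ℝ) / 10000)) (by norm_num) (by norm_num) (by norm_num) (by norm_num) (by norm_num) (by norm_num) (by norm_num) (by norm_num [dopingDisc]) hTH).2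
    refine le_trans hw ?_
    norm_num [fsRatio, fsD, fsN]

end Summit.Ventures.CertifiedManyBodySolver.Downfold.Emery
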